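import Literature.Algebra.Homology.OrderedCechLexSystem
import Literature.Algebra.Homology.OrderedCechShuffleCoefficient
import Literature.Algebra.Homology.OrderedCechSystemAlternating
import Mathlib.Algebra.Homology.TotalComplex
import Mathlib.Algebra.Homology.ComplexShapeSigns
import Mathlib.Data.Int.Interval
import HarnessLib

/-!
# The Eilenberg–Zilber pair on the ordered Čech bicomplex of a pair-system: components of the shuffle map `∇` and of the
# cross product `×` (Eilenberg–Mac Lane 1953 §5; The Stacks Project, Tag 0BEC)

Layer `Literature/Algebra/Homology` (constructions + unfolding lemmas; 0 named facts, no instance, no notation; pure homological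
algebra over a commutative ring `A`).  For a pair-system `P : Finset ι ⥤ Finset κ ⥤ ModuleCat A` (`Algebra/Homology/OrderedCechPairSystem`)
we have the ordered Čech BICOMPLEX `Č•,•(P)` (`sysBicomplex P`, `Čᵃ,ᵇ = Π_τ Π_σ P σ τ`) and the ordered Čech complex of the
LEXICOGRAPHIC system `Č(lexSystem P)` (`Algebra/Homology/OrderedCechLexSystem`: `T ↦ P (π₁T) (π₂T)` on `T ⊆ ι ×ₗ κ` — the Čech complex of
the product cover).  This file defines the COMPONENTS of the two comparison maps of the Künneth formula and the two generic
constructors assembling such components into morphisms to / from a total complex: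

* §1 `totalLift K E φ … : E ⟶ Tot K` / `totalDescHom K E ψ … : Tot K ⟶ E` — a morphism INTO (resp. OUT OF) the total complex of a
  first-quadrant bicomplex `K` of `C` (`ComplexShape.up ℤ` twice) from a family of components `φ n a b : Eⁿ ⟶ Kᵃᵇ` (resp.
  `ψ a b n : Kᵃᵇ ⟶ Eⁿ`) satisfying the evident compatibility with `d_E` and `D = d₁ + (-1)ᵃ d₂` (Mathlib's total sign `ε₂ (a,b) = (-1)ᵃ`,
  `ComplexShape.ε_up_ℤ`); `totalLift_f`, `ιTotal_totalDescHom_f`;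
* §2 `pairRestrict P hs ht : P s t ⟶ P s' t'` (restriction in both variables; `pairRestrict_comp`) and
  `SysCochain.boxEval c s t R : P s t` — the value of a cochain `c` of `lexSystem P` at `R ⊆ s × t`, read in `P s t` (`0` unless `R` is a
  simplex inside `s × t`; `boxEval_eq`, `map_boxEval`, additivity);
* §3 **`shuffleComponent P n a b : Čⁿ(lexSystem P) →ₗ Čᵃᵇ(P)`, `(∇c)(τ)(σ) = Σ_{T ⊆ σ × τ} m(σ,τ,T) · c_T|`** with the shuffle coefficients
  `m = shuffleCoeff` of `Algebra/Homology/OrderedCechShuffleCoefficient` (Eilenberg–Mac Lane's `∇`, dualised: a sum over the lattice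
  paths = `(a,b)`-shuffles);
* §4 **`crossComponent P a b n : Čᵃᵇ(P) →ₗ Čⁿ(lexSystem P)`, `(× x)(w₀ < ⋯ < w_n) = ± x(π₂-word of the back `b`-face)(π₁-set of the front
  `a`-face)|`** (Alexander–Whitney; the `π₂`-word of a lexicographic chain need not increase, whence the alternating evaluation
  `SysCochain.altEvalAt` of `Algebra/Homology/OrderedCechSystemAlternating` carries the sign; degenerate faces give `0`).

The cochain-map identities (`∇` and `×` are morphisms of complexes) and `× ≫ ∇ = 𝟙` are the sequels
`Algebra/Homology/OrderedCechPairSystem{ShuffleMap,CrossMap,EilenbergZilber}`.  Cell `hodgecm-mathlib` (D-0151), F-11 / J3 Künneth packet,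
bricks (K2-b)/(K2-c-2) of F0P1b-p04's plan (RULINGS #3 (R15), #4 (R20)).  HC_CM is proved only modulo the 7 printed citations until rung 0
closes — nothing here bears on a summit statement.

## References
* S. Eilenberg, S. Mac Lane, *On the groups `H(Π,n)`, I*, Ann. of Math. 58 (1953), §5 (the maps `∇`, `f × g`, Thm. 5.2). [EilenbergMacLane1953]
* The Stacks Project, Tag 0BEC (Künneth: the double Čech complex), Tag 012K (total complex), Tag 01FG. [StacksProject]
* U. Görtz, T. Wedhorn, *Algebraic Geometry II* (2023), Def. 21.64, Def. 21.68 (pp. 179–180). [GortzWedhorn2023]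
-/

universe w v u

open CategoryTheory CategoryTheory.Limits HomologicalComplex

set_option backward.isDefEq.respectTransparency false

noncomputable section

namespace Literature.Algebra.Homology

/-! ### §1 Morphisms into and out of the total complex of a first-quadrant bicomplex, from components -/

section Total

variable {C : Type w} [Category.{v} C] [Preadditive C]
  (K : HomologicalComplex₂ C (ComplexShape.up ℤ) (ComplexShape.up ℤ)) [K.HasTotal (ComplexShape.up ℤ)]
  (E : CochainComplex C ℤ)

/-- `π (a, b) = a + b` for the total shape of `ComplexShape.up ℤ` (`rfl`). [cite: StacksProject, Tag 012K] -/
theorem π_up_int (a b : ℤ) :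
    ComplexShape.π (ComplexShape.up ℤ) (ComplexShape.up ℤ) (ComplexShape.up ℤ) (a, b) = a + b := rfl

/-- The degree-`n` part of `totalLift`: `Σ_{0 ≤ a ≤ n} φ n a (n-a) ≫ ι_{a,n-a}`. [cite: StacksProject, Tag 012K] -/
def totalLiftF (φ : ∀ n a b : ℤ, (E.X n ⟶ (K.X a).X b)) (n : ℤ) : E.X n ⟶ (K.total (ComplexShape.up ℤ)).X n :=
  ∑ a ∈ Finset.Icc (0 : ℤ) n, φ n a (n - a) ≫ K.ιTotal (ComplexShape.up ℤ) a (n - a) n (by rw [π_up_int]; omega)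

variable {K E} in
/-- Re-indexing a `d₁`-term along equal indices (by `subst`). [cite: StacksProject, Tag 012K] -/
private theorem d₁Term_congr (φ : ∀ n a b : ℤ, (E.X n ⟶ (K.X a).X b)) (n m a' : ℤ) {a a₁ b b₁ : ℤ} (ha : a = a₁)
    (hb : b = b₁) (h : ComplexShape.π (ComplexShape.up ℤ) (ComplexShape.up ℤ) (ComplexShape.up ℤ) (a', b) = m)
    (h₁ : ComplexShape.π (ComplexShape.up ℤ) (ComplexShape.up ℤ) (ComplexShape.up ℤ) (a', b₁) = m) :
    (φ n a b ≫ (K.d a a').f b) ≫ K.ιTotal (ComplexShape.up ℤ) a' b m h =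
      (φ n a₁ b₁ ≫ (K.d a₁ a').f b₁) ≫ K.ιTotal (ComplexShape.up ℤ) a' b₁ m h₁ := by
  subst ha hb; rfl

/-- **`totalLiftF` commutes with the differentials** when `K` is first-quadrant and the components satisfy
`d_E ≫ φ_{a',b'} = φ_{a,b'} ≫ d₁ + (-1)^{a'} φ_{a',b} ≫ d₂` (`a' = a+1`, `b' = b+1`). [cite: StacksProject, Tag 012K] -/
theorem totalLiftF_comm (h₁ : ∀ a b : ℤ, a < 0 → IsZero ((K.X a).X b)) (h₂ : ∀ a b : ℤ, b < 0 → IsZero ((K.X a).X b))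
    (φ : ∀ n a b : ℤ, (E.X n ⟶ (K.X a).X b))
    (hφ : ∀ n n' a a' b b' : ℤ, n + 1 = n' → a + 1 = a' → b + 1 = b' → a' + b' = n' →
      E.d n n' ≫ φ n' a' b' = φ n a b' ≫ (K.d a a').f b' + ((a'.negOnePow : ℤˣ) : ℤ) • (φ n a' b ≫ (K.X a').d b b'))
    (n : ℤ) :
    totalLiftF K E φ n ≫ (K.total (ComplexShape.up ℤ)).d n (n + 1) = E.d n (n + 1) ≫ totalLiftF K E φ (n + 1) := by
  set T₁ : ℤ → (E.X n ⟶ (K.total (ComplexShape.up ℤ)).X (n + 1)) := fun a =>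
    (φ n a (n - a) ≫ (K.d a (a + 1)).f (n - a)) ≫ K.ιTotal (ComplexShape.up ℤ) (a + 1) (n - a) (n + 1)
      (by rw [π_up_int]; omega) with hT₁
  set T₂ : ℤ → (E.X n ⟶ (K.total (ComplexShape.up ℤ)).X (n + 1)) := fun a =>
    ((a.negOnePow : ℤˣ) : ℤ) • ((φ n a (n - a) ≫ (K.X a).d (n - a) (n + 1 - a)) ≫
      K.ιTotal (ComplexShape.up ℤ) a (n + 1 - a) (n + 1) (by rw [π_up_int]; omega)) with hT₂
  have lhs : totalLiftF K E φ n ≫ (K.total (ComplexShape.up ℤ)).d n (n + 1) =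
      ∑ a ∈ Finset.Icc (0 : ℤ) n, T₁ a + ∑ a ∈ Finset.Icc (0 : ℤ) n, T₂ a := by
    unfold totalLiftF
    rw [Preadditive.sum_comp, ← Finset.sum_add_distrib]
    refine Finset.sum_congr rfl fun a _ => ?_
    rw [HomologicalComplex₂.total_d, Preadditive.comp_add, Category.assoc, Category.assoc,
      HomologicalComplex₂.ι_D₁, HomologicalComplex₂.ι_D₂,
      K.d₁_eq (ComplexShape.up ℤ) (show (ComplexShape.up ℤ).Rel a (a + 1) by simp) (n - a) (n + 1)
        (by rw [π_up_int]; omega),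
      K.d₂_eq (ComplexShape.up ℤ) a (show (ComplexShape.up ℤ).Rel (n - a) (n + 1 - a) by simp; omega) (n + 1)
        (by rw [π_up_int]; omega)]
    rw [hT₁, hT₂]
    dsimp only
    simp only [ComplexShape.ε₁_def, ComplexShape.ε₂_def, ComplexShape.ε_up_ℤ, one_smul, Units.smul_def,
      Preadditive.comp_zsmul, Category.assoc]
  have rhs : E.d n (n + 1) ≫ totalLiftF K E φ (n + 1) =
      ∑ a ∈ Finset.Icc (0 : ℤ) (n + 1), (φ n (a - 1) (n + 1 - a) ≫ (K.d (a - 1) a).f (n + 1 - a)) ≫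
          K.ιTotal (ComplexShape.up ℤ) a (n + 1 - a) (n + 1) (by rw [π_up_int]; omega) +
        ∑ a ∈ Finset.Icc (0 : ℤ) (n + 1), T₂ a := by
    unfold totalLiftF
    rw [Preadditive.comp_sum, ← Finset.sum_add_distrib]
    refine Finset.sum_congr rfl fun a _ => ?_
    have e := hφ n (n + 1) (a - 1) a (n - a) (n + 1 - a) rfl (by omega) (by omega) (by omega)
    rw [← Category.assoc, e, Preadditive.add_comp, hT₂]
    dsimp only
    rw [Preadditive.zsmul_comp]
  rw [lhs, rhs]
  congr 1
  · -- `d₁`-terms: drop `a = 0` on the right (`K_{-1,n+1} = 0`) and shift `a ↦ a + 1`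
    refine Eq.trans ?_ (Finset.sum_subset (s₁ := Finset.Icc 1 (n + 1)) (Finset.Icc_subset_Icc (by omega) le_rfl)
      fun a ha ha' => ?_)
    swap
    · have ha0 : a - 1 < 0 := by
        simp only [Finset.mem_Icc, not_and, not_le] at ha ha'; omega
      rw [(h₁ (a - 1) (n + 1 - a) ha0).eq_of_tgt (φ n (a - 1) (n + 1 - a)) 0, zero_comp, zero_comp]
    refine Finset.sum_bij' (fun a _ => a + 1) (fun a _ => a - 1) ?_ ?_ ?_ ?_ ?_
    · intro a ha; simp only [Finset.mem_Icc] at ha ⊢; omega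
    · intro a ha; simp only [Finset.mem_Icc] at ha ⊢; omega
    · intro a _; omega
    · intro a _; omega
    · intro a _
      rw [hT₁]
      exact d₁Term_congr φ n (n + 1) (a + 1) (by omega) (by omega) _ _
  · -- `d₂`-terms: drop `a = n + 1` on the right (`K_{n+1,-1} = 0`)
    refine Finset.sum_subset (Finset.Icc_subset_Icc_right (by omega)) fun a ha ha' => ?_
    have hlt : n - a < 0 := by
      simp only [Finset.mem_Icc, not_and, not_le] at ha ha'; omega
    rw [hT₂]
    dsimp only
    rw [(h₂ a (n - a) hlt).eq_of_tgt (φ n a (n - a)) 0, zero_comp, zero_comp, smul_zero]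

/-- **A morphism INTO the total complex from components.**  For a first-quadrant bicomplex `K` (`Kᵃᵇ = 0` for `a < 0` or
`b < 0`), a cochain complex `E` and components `φ n a b : Eⁿ ⟶ Kᵃᵇ` with `d_E ≫ φ = φ ≫ d₁ + (-1)ᵃ φ ≫ d₂` (Mathlib's total
differential `D = d₁ + ε₂ d₂`, `ε₂ (a,b) = (-1)ᵃ`), the morphism `E ⟶ Tot K` with `n`-th part `Σ_{a=0}^{n} φ n a (n-a) ≫ ι_{a,n-a}`.
[cite: StacksProject, Tag 012K] -/
def totalLift (h₁ : ∀ a b : ℤ, a < 0 → IsZero ((K.X a).X b)) (h₂ : ∀ a b : ℤ, b < 0 → IsZero ((K.X a).X b))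
    (φ : ∀ n a b : ℤ, (E.X n ⟶ (K.X a).X b))
    (hφ : ∀ n n' a a' b b' : ℤ, n + 1 = n' → a + 1 = a' → b + 1 = b' → a' + b' = n' →
      E.d n n' ≫ φ n' a' b' = φ n a b' ≫ (K.d a a').f b' + ((a'.negOnePow : ℤˣ) : ℤ) • (φ n a' b ≫ (K.X a').d b b')) :
    E ⟶ K.total (ComplexShape.up ℤ) where
  f n := totalLiftF K E φ n
  comm' n m hnm := by
    obtain rfl : n + 1 = m := hnm
    exact totalLiftF_comm K E h₁ h₂ φ hφ n

/-- The parts of `totalLift` (`rfl`). [cite: StacksProject, Tag 012K] -/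
@[simp] theorem totalLift_f (h₁ h₂) (φ : ∀ n a b : ℤ, (E.X n ⟶ (K.X a).X b)) (hφ) (n : ℤ) :
    (totalLift K E h₁ h₂ φ hφ).f n = totalLiftF K E φ n := rfl

/-- The degree-`n` part of `totalDescHom`: `totalDesc` of the components. [cite: StacksProject, Tag 012K] -/
def totalDescF (ψ : ∀ a b n : ℤ, ((K.X a).X b ⟶ E.X n)) (n : ℤ) : (K.total (ComplexShape.up ℤ)).X n ⟶ E.X n :=
  K.totalDesc fun a b _ => ψ a b n

/-- `ι_{a,b} ≫ totalDescF n = ψ a b n`. [cite: StacksProject, Tag 012K] -/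
@[simp] theorem ιTotal_totalDescF (ψ : ∀ a b n : ℤ, ((K.X a).X b ⟶ E.X n)) (a b n : ℤ)
    (h : ComplexShape.π (ComplexShape.up ℤ) (ComplexShape.up ℤ) (ComplexShape.up ℤ) (a, b) = n) :
    K.ιTotal (ComplexShape.up ℤ) a b n h ≫ totalDescF K E ψ n = ψ a b n := by
  unfold totalDescF
  rw [K.ι_totalDesc]

/-- **`totalDescF` commutes with the differentials** when the components satisfy
`ψ_{a,b} ≫ d_E = d₁ ≫ ψ_{a+1,b} + (-1)ᵃ d₂ ≫ ψ_{a,b+1}`. [cite: StacksProject, Tag 012K] -/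
theorem totalDescF_comm (ψ : ∀ a b n : ℤ, ((K.X a).X b ⟶ E.X n))
    (hψ : ∀ n n' a a' b b' : ℤ, n + 1 = n' → a + 1 = a' → b + 1 = b' → a + b = n →
      ψ a b n ≫ E.d n n' = (K.d a a').f b ≫ ψ a' b n' + ((a.negOnePow : ℤˣ) : ℤ) • ((K.X a).d b b' ≫ ψ a b' n'))
    (n : ℤ) :
    totalDescF K E ψ n ≫ E.d n (n + 1) = (K.total (ComplexShape.up ℤ)).d n (n + 1) ≫ totalDescF K E ψ (n + 1) := by
  refine HomologicalComplex₂.total.hom_ext _ fun a b hab => ?_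
  rw [π_up_int] at hab
  rw [← Category.assoc, ιTotal_totalDescF, hψ n (n + 1) a (a + 1) b (b + 1) rfl rfl rfl hab, HomologicalComplex₂.total_d,
    Preadditive.add_comp, Preadditive.comp_add, HomologicalComplex₂.ι_D₁_assoc, HomologicalComplex₂.ι_D₂_assoc,
    K.d₁_eq (ComplexShape.up ℤ) (show (ComplexShape.up ℤ).Rel a (a + 1) by simp) b (n + 1) (by rw [π_up_int]; omega),
    K.d₂_eq (ComplexShape.up ℤ) a (show (ComplexShape.up ℤ).Rel b (b + 1) by simp) (n + 1) (by rw [π_up_int]; omega)]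
  simp only [ComplexShape.ε₁_def, ComplexShape.ε₂_def, ComplexShape.ε_up_ℤ, one_smul, Units.smul_def,
    Preadditive.zsmul_comp, Category.assoc, ιTotal_totalDescF]

/-- **A morphism OUT OF the total complex from components** `ψ a b n : Kᵃᵇ ⟶ Eⁿ` with
`ψ ≫ d_E = d₁ ≫ ψ + (-1)ᵃ d₂ ≫ ψ`. [cite: StacksProject, Tag 012K] -/
def totalDescHom (ψ : ∀ a b n : ℤ, ((K.X a).X b ⟶ E.X n))
    (hψ : ∀ n n' a a' b b' : ℤ, n + 1 = n' → a + 1 = a' → b + 1 = b' → a + b = n →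
      ψ a b n ≫ E.d n n' = (K.d a a').f b ≫ ψ a' b n' + ((a.negOnePow : ℤˣ) : ℤ) • ((K.X a).d b b' ≫ ψ a b' n')) :
    K.total (ComplexShape.up ℤ) ⟶ E where
  f n := totalDescF K E ψ n
  comm' n m hnm := by
    obtain rfl : n + 1 = m := hnm
    exact totalDescF_comm K E ψ hψ n

/-- `ι_{a,b} ≫ (totalDescHom ψ).f n = ψ a b n`. [cite: StacksProject, Tag 012K] -/
@[simp] theorem ιTotal_totalDescHom_f (ψ : ∀ a b n : ℤ, ((K.X a).X b ⟶ E.X n)) (hψ) (a b n : ℤ)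
    (h : ComplexShape.π (ComplexShape.up ℤ) (ComplexShape.up ℤ) (ComplexShape.up ℤ) (a, b) = n) :
    K.ιTotal (ComplexShape.up ℤ) a b n h ≫ (totalDescHom K E ψ hψ).f n = ψ a b n :=
  ιTotal_totalDescF K E ψ a b n h

end Total

namespace OrderedCech

variable {A : Type u} [CommRing A] {ι κ : Type} (P : Finset ι ⥤ Finset κ ⥤ ModuleCat.{u} A)

/-! ### §2 Restriction in both variables; reading a cochain of the lexicographic system inside a rectangle -/

/-- Restriction of the pair-system in both variables: `P s t ⟶ P s' t'` for `s ⊆ s'`, `t ⊆ t'` (first in `s`, then in `t`).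
[cite: StacksProject, Tag 0BEC] -/
def pairRestrict {s s' : Finset ι} {t t' : Finset κ} (hs : s ⊆ s') (ht : t ⊆ t') : (P.obj s).obj t ⟶ (P.obj s').obj t' :=
  (P.map (homOfLE hs)).app t ≫ (P.obj s').map (homOfLE ht)

/-- `pairRestrict` along the identity is the identity. [cite: StacksProject, Tag 0BEC] -/
@[simp] theorem pairRestrict_refl (s : Finset ι) (t : Finset κ) :
    pairRestrict P (subset_refl s) (subset_refl t) = 𝟙 _ := by
  unfold pairRestrict
  rw [show homOfLE (subset_refl s) = 𝟙 s from rfl, show homOfLE (subset_refl t) = 𝟙 t from rfl, P.map_id,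
    (P.obj s).map_id, NatTrans.id_app, Category.id_comp]

/-- `pairRestrict` composes. [cite: StacksProject, Tag 0BEC] -/
theorem pairRestrict_comp {s s' s'' : Finset ι} {t t' t'' : Finset κ} (hs : s ⊆ s') (ht : t ⊆ t') (hs' : s' ⊆ s'')
    (ht' : t' ⊆ t'') :
    pairRestrict P hs ht ≫ pairRestrict P hs' ht' = pairRestrict P (hs.trans hs') (ht.trans ht') := by
  unfold pairRestrict
  rw [show homOfLE (hs.trans hs') = homOfLE hs ≫ homOfLE hs' from rfl,
    show homOfLE (ht.trans ht') = homOfLE ht ≫ homOfLE ht' from rfl, P.map_comp, NatTrans.comp_app, Functor.map_comp,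
    Category.assoc, Category.assoc]
  congr 1
  rw [← Category.assoc, NatTrans.naturality, Category.assoc]

/-- `pairRestrict` on elements composes. [cite: StacksProject, Tag 0BEC] -/
theorem pairRestrict_pairRestrict_apply {s s' s'' : Finset ι} {t t' t'' : Finset κ} (hs : s ⊆ s') (ht : t ⊆ t')
    (hs' : s' ⊆ s'') (ht' : t' ⊆ t'') (x : (P.obj s).obj t) :
    (pairRestrict P hs' ht').hom ((pairRestrict P hs ht).hom x) = (pairRestrict P (hs.trans hs') (ht.trans ht')).hom x := by
  rw [← ModuleCat.comp_apply, pairRestrict_comp]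

variable [LinearOrder ι] [LinearOrder κ]

/-- The restriction maps of `lexSystem P` are `pairRestrict` along the two projections (`rfl`). [cite: StacksProject, Tag 0BEC] -/
theorem lexSystem_map_eq_pairRestrict {T T' : Finset (ι ×ₗ κ)} (h : T ⟶ T') :
    (lexSystem P).map h = pairRestrict P (fstProj_mono h.le) (sndProj_mono h.le) := rfl

/-- `π₁ (s × t) ⊆ s`. [cite: StacksProject, Tag 0BEC] -/
theorem fstProj_image_toLex_subset (s : Finset ι) (t : Finset κ) :
    fstProj ((s ×ˢ t).image toLex) ⊆ s := by
  intro i hi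
  obtain ⟨w, hw, rfl⟩ := mem_fstProj.mp hi
  exact (mem_image_toLex.mp hw).1

/-- `π₂ (s × t) ⊆ t`. [cite: StacksProject, Tag 0BEC] -/
theorem sndProj_image_toLex_subset (s : Finset ι) (t : Finset κ) :
    sndProj ((s ×ˢ t).image toLex) ⊆ t := by
  intro j hj
  obtain ⟨w, hw, rfl⟩ := mem_sndProj.mp hj
  exact (mem_image_toLex.mp hw).2

/-- `T ⊆ s × t ↔ π₁T ⊆ s ∧ π₂T ⊆ t`. [cite: StacksProject, Tag 0BEC] -/
theorem subset_image_toLex_iff {T : Finset (ι ×ₗ κ)} {s : Finset ι} {t : Finset κ} :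
    T ⊆ (s ×ˢ t).image toLex ↔ fstProj T ⊆ s ∧ sndProj T ⊆ t := by
  constructor
  · intro h
    exact ⟨(fstProj_mono h).trans (fstProj_image_toLex_subset s t), (sndProj_mono h).trans (sndProj_image_toLex_subset s t)⟩
  · rintro ⟨h1, h2⟩ w hw
    exact mem_image_toLex.mpr ⟨h1 (fst_mem_fstProj hw), h2 (snd_mem_sndProj hw)⟩

variable {P} in
/-- **The value of a cochain of the lexicographic system at `R`, read in `P s t`**: `pairRestrict (c_R)` along `π₁R ⊆ s`,
`π₂R ⊆ t` when `R` is an `n`-simplex with `π₁R ⊆ s`, `π₂R ⊆ t`, and `0` otherwise. [cite: StacksProject, Tag 0BEC]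
[cite: EilenbergMacLane1953, §5] -/
def SysCochain.boxEval {n : ℤ} (c : SysCochain (lexSystem P) n) (s : Finset ι) (t : Finset κ) (R : Finset (ι ×ₗ κ)) :
    (P.obj s).obj t :=
  if h : (R.Nonempty ∧ (R.card : ℤ) = n + 1) ∧ fstProj R ⊆ s ∧ sndProj R ⊆ t then
    (pairRestrict P h.2.1 h.2.2).hom (c ⟨R, h.1⟩) else 0

variable {P}

/-- `boxEval` on an `n`-simplex inside `s × t`. [cite: StacksProject, Tag 0BEC] -/
theorem SysCochain.boxEval_eq {n : ℤ} (c : SysCochain (lexSystem P) n) {s : Finset ι} {t : Finset κ}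
    (R : Simplex (ι ×ₗ κ) n) (h1 : fstProj R.1 ⊆ s) (h2 : sndProj R.1 ⊆ t) :
    c.boxEval s t R.1 = (pairRestrict P h1 h2).hom (c R) := by
  obtain ⟨R, hR⟩ := R
  unfold SysCochain.boxEval
  rw [dif_pos ⟨hR, h1, h2⟩]

/-- `boxEval` vanishes off the simplices inside `s × t`. [cite: StacksProject, Tag 0BEC] -/
theorem SysCochain.boxEval_eq_zero {n : ℤ} (c : SysCochain (lexSystem P) n) {s : Finset ι} {t : Finset κ}
    {R : Finset (ι ×ₗ κ)} (h : ¬ ((R.Nonempty ∧ (R.card : ℤ) = n + 1) ∧ fstProj R ⊆ s ∧ sndProj R ⊆ t)) :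
    c.boxEval s t R = 0 := by
  unfold SysCochain.boxEval
  rw [dif_neg h]

/-- `boxEval` is additive in the cochain. [cite: StacksProject, Tag 0BEC] -/
theorem SysCochain.boxEval_add {n : ℤ} (c c' : SysCochain (lexSystem P) n) (s : Finset ι) (t : Finset κ)
    (R : Finset (ι ×ₗ κ)) : (c + c').boxEval s t R = c.boxEval s t R + c'.boxEval s t R := by
  unfold SysCochain.boxEval
  split_ifs with h
  · exact map_add _ _ _
  · rw [add_zero]

/-- `boxEval` is homogeneous in the cochain. [cite: StacksProject, Tag 0BEC] -/
theorem SysCochain.boxEval_smul {n : ℤ} (r : A) (c : SysCochain (lexSystem P) n) (s : Finset ι) (t : Finset κ)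
    (R : Finset (ι ×ₗ κ)) : (r • c).boxEval s t R = r • c.boxEval s t R := by
  unfold SysCochain.boxEval
  split_ifs with h
  · exact map_smul _ _ _
  · rw [smul_zero]

/-- **Functoriality of `boxEval`**: restricting `c.boxEval s t R` to a bigger rectangle `s' × t'` gives `c.boxEval s' t' R`, provided
`π₁R ⊆ s`, `π₂R ⊆ t`. [cite: StacksProject, Tag 0BEC] -/
theorem SysCochain.map_boxEval {n : ℤ} (c : SysCochain (lexSystem P) n) {s s' : Finset ι} {t t' : Finset κ} (hs : s ⊆ s')
    (ht : t ⊆ t') {R : Finset (ι ×ₗ κ)} (hR : fstProj R ⊆ s ∧ sndProj R ⊆ t) :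
    (pairRestrict P hs ht).hom (c.boxEval s t R) = c.boxEval s' t' R := by
  unfold SysCochain.boxEval
  by_cases h : R.Nonempty ∧ (R.card : ℤ) = n + 1
  · rw [dif_pos ⟨h, hR⟩, dif_pos ⟨h, hR.1.trans hs, hR.2.trans ht⟩, pairRestrict_pairRestrict_apply]
  · rw [dif_neg (fun h' => h h'.1), dif_neg (fun h' => h h'.1), map_zero]

/-- Restricting `c.boxEval s t R` in the first variable. [cite: StacksProject, Tag 0BEC] -/
theorem SysCochain.map_app_boxEval {n : ℤ} (c : SysCochain (lexSystem P) n) {s s' : Finset ι} (hs : s ⊆ s') (t : Finset κ)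
    {R : Finset (ι ×ₗ κ)} (hR : fstProj R ⊆ s ∧ sndProj R ⊆ t) :
    ((P.map (homOfLE hs)).app t).hom (c.boxEval s t R) = c.boxEval s' t R := by
  rw [← c.map_boxEval hs (subset_refl t) hR]
  unfold pairRestrict
  rw [show homOfLE (subset_refl t) = 𝟙 t from rfl, (P.obj s').map_id, Category.comp_id]

/-- Restricting `c.boxEval s t R` in the second variable. [cite: StacksProject, Tag 0BEC] -/
theorem SysCochain.obj_map_boxEval {n : ℤ} (c : SysCochain (lexSystem P) n) (s : Finset ι) {t t' : Finset κ} (ht : t ⊆ t')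
    {R : Finset (ι ×ₗ κ)} (hR : fstProj R ⊆ s ∧ sndProj R ⊆ t) :
    ((P.obj s).map (homOfLE ht)).hom (c.boxEval s t R) = c.boxEval s t' R := by
  rw [← c.map_boxEval (subset_refl s) ht hR]
  unfold pairRestrict
  rw [show homOfLE (subset_refl s) = 𝟙 s from rfl, P.map_id, NatTrans.id_app, Category.id_comp]

/-- `boxEval` in terms of `ext0At` of the lexicographic system: `c.boxEval s t R = pairRestrict (c.ext0At R (s × t))`.
[cite: StacksProject, Tag 0BEC] -/
theorem SysCochain.boxEval_eq_pairRestrict_ext0At {n : ℤ} (c : SysCochain (lexSystem P) n)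
    (s : Finset ι) (t : Finset κ) (R : Finset (ι ×ₗ κ)) :
    c.boxEval s t R = (pairRestrict P (fstProj_image_toLex_subset s t) (sndProj_image_toLex_subset s t)).hom
      (c.ext0At R ((s ×ˢ t).image toLex)) := by
  unfold SysCochain.boxEval SysCochain.ext0At
  by_cases h : (R.Nonempty ∧ (R.card : ℤ) = n + 1) ∧ fstProj R ⊆ s ∧ sndProj R ⊆ t
  · have h' : (R.Nonempty ∧ (R.card : ℤ) = n + 1) ∧ R ⊆ (s ×ˢ t).image toLex := ⟨h.1, subset_image_toLex_iff.mpr h.2⟩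
    rw [dif_pos h, dif_pos h']
    exact (pairRestrict_pairRestrict_apply P _ _ _ _ _).symm
  · have h' : ¬ ((R.Nonempty ∧ (R.card : ℤ) = n + 1) ∧ R ⊆ (s ×ˢ t).image toLex) := fun h' =>
      h ⟨h'.1, subset_image_toLex_iff.mp h'.2⟩
    rw [dif_neg h, dif_neg h', map_zero]

/-! ### §3 The components of the shuffle map `∇ : Č(lexSystem P) ⟶ Tot Č•,•(P)` -/

variable (P)

/-- **The `(a,b)`-component of the shuffle (Eilenberg–Zilber) map on `n`-cochains of the lexicographic system**:
`(∇c)(τ)(σ) = Σ_{T ⊆ σ × τ} m(σ, τ, T) · c_T|_{P σ τ}` — the signed sum over the lattice paths (`= (a,b)`-shuffles) from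
`(min σ, min τ)` to `(max σ, max τ)`, `m = shuffleCoeff` (zero automatically unless `a + b = n`). [cite: EilenbergMacLane1953, §5]
[cite: StacksProject, Tag 0BEC] -/
def shuffleComponent (n a b : ℤ) : SysCochain (lexSystem P) n →ₗ[A] SysCochain (cochainSystem P a) b where
  toFun c := fun (τ : Simplex κ b) (σ : Simplex ι a) =>
    ∑ T ∈ ((σ.1 ×ˢ τ.1).image toLex).powerset, ((shuffleCoeff σ.1 τ.1 T : ℤ) : A) • c.boxEval σ.1 τ.1 T
  map_add' c c' := by
    funext τ σ
    change ∑ T ∈ ((σ.1 ×ˢ τ.1).image toLex).powerset, ((shuffleCoeff σ.1 τ.1 T : ℤ) : A) • (c + c').boxEval σ.1 τ.1 T =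
      ∑ T ∈ ((σ.1 ×ˢ τ.1).image toLex).powerset, ((shuffleCoeff σ.1 τ.1 T : ℤ) : A) • c.boxEval σ.1 τ.1 T +
        ∑ T ∈ ((σ.1 ×ˢ τ.1).image toLex).powerset, ((shuffleCoeff σ.1 τ.1 T : ℤ) : A) • c'.boxEval σ.1 τ.1 T
    rw [← Finset.sum_add_distrib]
    exact Finset.sum_congr rfl fun T _ => by rw [SysCochain.boxEval_add, smul_add]
  map_smul' r c := by
    funext τ σ
    change ∑ T ∈ ((σ.1 ×ˢ τ.1).image toLex).powerset, ((shuffleCoeff σ.1 τ.1 T : ℤ) : A) • (r • c).boxEval σ.1 τ.1 T =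
      r • ∑ T ∈ ((σ.1 ×ˢ τ.1).image toLex).powerset, ((shuffleCoeff σ.1 τ.1 T : ℤ) : A) • c.boxEval σ.1 τ.1 T
    rw [Finset.smul_sum]
    exact Finset.sum_congr rfl fun T _ => by rw [SysCochain.boxEval_smul, smul_comm]

/-- The shuffle component on elements (`rfl`). [cite: EilenbergMacLane1953, §5] -/
theorem shuffleComponent_apply (n a b : ℤ) (c : SysCochain (lexSystem P) n) (τ : Simplex κ b) (σ : Simplex ι a) :
    shuffleComponent P n a b c τ σ =
      ∑ T ∈ ((σ.1 ×ˢ τ.1).image toLex).powerset, ((shuffleCoeff σ.1 τ.1 T : ℤ) : A) • c.boxEval σ.1 τ.1 T := rfl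

/-! ### §4 The components of the cross product `× : Tot Č•,•(P) ⟶ Č(lexSystem P)` -/

/-- The `π₂`-word of the BACK `b`-face `(w_a, …, w_{a+b})` of a chain `T = {w₀ < ⋯ < w_{a+b}}` of `ι ×ₗ κ` (it need not increase).
[cite: EilenbergMacLane1953, §5] -/
def backWord (T : Finset (ι ×ₗ κ)) {a b : ℕ} (h : T.card = a + b + 1) : Fin (b + 1) → κ :=
  fun k => (ofLex (T.orderEmbOfFin h ⟨a + k, by omega⟩)).2

/-- The `π₁`-word of the FRONT `a`-face `(w₀, …, w_a)` of a chain `T` of `ι ×ₗ κ` (non-decreasing; injective iff the front face is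
non-degenerate in `ι`). [cite: EilenbergMacLane1953, §5] -/
def frontWord (T : Finset (ι ×ₗ κ)) {a b : ℕ} (h : T.card = a + b + 1) : Fin (a + 1) → ι :=
  fun k => (ofLex (T.orderEmbOfFin h ⟨k, by omega⟩)).1

variable {P} in
/-- **Double alternating evaluation** of `x ∈ Čᵃᵇ(P) = Π_τ Π_σ P σ τ` at a pair of words `(α, β)`, read in `P s t`: first the `κ`-word `β`
(`SysCochain.altEvalAt` for the `κ`-system `Čᵃ(P(·, t))`), then the `ι`-word `α` (for the `ι`-system `P(·, t)`); each carries the sign of its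
sorting permutation and vanishes on a repeated letter. [cite: EilenbergMacLane1953, §5] [cite: StacksProject, Tag 01FG] -/
def SysCochain.crossRead {a b : ℤ} (x : SysCochain (cochainSystem P a) b) {p q : ℕ} (α : Fin p → ι) (β : Fin q → κ)
    (s : Finset ι) (t : Finset κ) : (P.obj s).obj t :=
  SysCochain.altEvalAt (M := P.flip.obj t) (x.altEvalAt β t) α s

/-- `crossRead` is additive in the cochain. [cite: EilenbergMacLane1953, §5] -/
theorem SysCochain.crossRead_add {a b : ℤ} (x x' : SysCochain (cochainSystem P a) b) {p q : ℕ} (α : Fin p → ι)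
    (β : Fin q → κ) (s : Finset ι) (t : Finset κ) :
    (x + x').crossRead α β s t = x.crossRead α β s t + x'.crossRead α β s t := by
  unfold SysCochain.crossRead
  rw [SysCochain.altEvalAt_add, SysCochain.altEvalAt_add]

/-- `crossRead` is homogeneous in the cochain. [cite: EilenbergMacLane1953, §5] -/
theorem SysCochain.crossRead_smul {a b : ℤ} (r : A) (x : SysCochain (cochainSystem P a) b) {p q : ℕ} (α : Fin p → ι)
    (β : Fin q → κ) (s : Finset ι) (t : Finset κ) : (r • x).crossRead α β s t = r • x.crossRead α β s t := by
  unfold SysCochain.crossRead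
  rw [SysCochain.altEvalAt_smul, SysCochain.altEvalAt_smul]

/-- In range, an `n`-simplex has `a + b + 1` vertices. [cite: EilenbergMacLane1953, §5] -/
theorem crossCard {a b n : ℤ} (h : 0 ≤ a ∧ 0 ≤ b ∧ a + b = n) (T : Simplex (ι ×ₗ κ) n) :
    T.1.card = a.toNat + b.toNat + 1 := by
  have := T.2.2; omega

/-- The value of the cross product in range: `x` read at (front `π₁`-word, back `π₂`-word) of `T` in `P (π₁T) (π₂T)`.
[cite: EilenbergMacLane1953, §5] [cite: StacksProject, Tag 0BEC] -/
def crossValue {a b n : ℤ} (h : 0 ≤ a ∧ 0 ≤ b ∧ a + b = n) (x : SysCochain (cochainSystem P a) b)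
    (T : Simplex (ι ×ₗ κ) n) : (lexSystem P).obj T.1 :=
  x.crossRead (frontWord T.1 (crossCard h T)) (backWord T.1 (crossCard h T)) (fstProj T.1) (sndProj T.1)

/-- `crossValue` is additive. [cite: EilenbergMacLane1953, §5] -/
theorem crossValue_add {a b n : ℤ} (h : 0 ≤ a ∧ 0 ≤ b ∧ a + b = n) (x x' : SysCochain (cochainSystem P a) b)
    (T : Simplex (ι ×ₗ κ) n) : crossValue P h (x + x') T = crossValue P h x T + crossValue P h x' T :=
  SysCochain.crossRead_add P x x' _ _ _ _

/-- `crossValue` is homogeneous. [cite: EilenbergMacLane1953, §5] -/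
theorem crossValue_smul {a b n : ℤ} (h : 0 ≤ a ∧ 0 ≤ b ∧ a + b = n) (r : A) (x : SysCochain (cochainSystem P a) b)
    (T : Simplex (ι ×ₗ κ) n) : crossValue P h (r • x) T = r • crossValue P h x T :=
  SysCochain.crossRead_smul P r x _ _ _ _

/-- **The `(a,b)`-component of the cross product (Alexander–Whitney map) into `n`-cochains of the lexicographic system**:
for `x ∈ Čᵃᵇ(P) = Π_τ Π_σ P σ τ` and a chain `T = {w₀ < ⋯ < w_n}`, `n = a + b`, `(× x)_T = crossValue x T =
x(π₂(w_a, …, w_n))(π₁{w₀, …, w_a})|` (signed, degenerate faces `0`); the zero map unless `0 ≤ a`, `0 ≤ b`, `a + b = n`.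
[cite: EilenbergMacLane1953, §5] [cite: StacksProject, Tag 0BEC] -/
def crossComponent (a b n : ℤ) : SysCochain (cochainSystem P a) b →ₗ[A] SysCochain (lexSystem P) n where
  toFun x := fun T => if h : 0 ≤ a ∧ 0 ≤ b ∧ a + b = n then crossValue P h x T else 0
  map_add' x x' := by
    funext T
    show (if h : 0 ≤ a ∧ 0 ≤ b ∧ a + b = n then crossValue P h (x + x') T else 0) =
      (if h : 0 ≤ a ∧ 0 ≤ b ∧ a + b = n then crossValue P h x T else 0) +
        (if h : 0 ≤ a ∧ 0 ≤ b ∧ a + b = n then crossValue P h x' T else 0)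
    split_ifs with h
    · exact crossValue_add P h x x' T
    · exact (add_zero _).symm
  map_smul' r x := by
    funext T
    show (if h : 0 ≤ a ∧ 0 ≤ b ∧ a + b = n then crossValue P h (r • x) T else 0) =
      r • (if h : 0 ≤ a ∧ 0 ≤ b ∧ a + b = n then crossValue P h x T else 0)
    split_ifs with h
    · exact crossValue_smul P h r x T
    · exact (smul_zero _).symm

/-- The cross component on elements, in range. [cite: EilenbergMacLane1953, §5] -/
theorem crossComponent_apply_of {a b n : ℤ} (h : 0 ≤ a ∧ 0 ≤ b ∧ a + b = n) (x : SysCochain (cochainSystem P a) b)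
    (T : Simplex (ι ×ₗ κ) n) : crossComponent P a b n x T = crossValue P h x T := by
  change dite _ _ _ = _
  rw [dif_pos h]

/-- The cross component vanishes out of range. [cite: EilenbergMacLane1953, §5] -/
theorem crossComponent_of_not {a b n : ℤ} (h : ¬ (0 ≤ a ∧ 0 ≤ b ∧ a + b = n)) : crossComponent P a b n = 0 := by
  apply LinearMap.ext
  intro x
  funext T
  change dite _ _ _ = _
  rw [dif_neg h]
  rfl

end OrderedCech

end Literature.Algebra.Homology

end
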